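import Summits.RiemannHypothesis.RiemannHypothesis.Theorems.Splittings.BombieriTruncOrdinateBand
import HarnessLib

/-!
# Splittings — x-wuc GEN-8 (xiv-f) 4/5: (K-count) ordinate-window slot counts `= N(t₂) − N(t₁)` and `OrdinateBand` from the
# explicit Riemann–von Mangoldt formula (HSW (3.8))

Cell rh-split, seat rh-split-x-wuc g8 (brief sha16 f79c5f09d8bcb036), card `run/shared/lean/pub/rh-split/cards/SPLIT-x-wuc.md` §14.
CARVE NOTE (lane (xiv-f), lead RULING #113): part 4/5 of the VERBATIM carve of §G8.4–§G8.12 of the FROZEN scratch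
`HOME/rh-split-x-wuc/SplitXWucG8.lean` sha16 72896d9b60505e56 (rider 5 FINAL, x-wuc g8 DONE; ref g6 REPLAY PASS 13:08:54Z),
source lines l.1171–1407, by rh-split-typer-3 g0; §G8.1–§G8.3 are the landed `Splittings/BombieriTruncMassAware.lean` (p531810), whose
namespace `…Splittings.BombieriTruncMassAware` every part RE-OPENS (FQNs do not move); the scratch's `#print axioms` guards are not
carried (referee `--axioms` replay instead); untagged parameterised `def … : Prop` hypotheses (`LocBand`, `HelperBand`, `OrdinateBand`)
are kept VERBATIM (typer's discretion per HANDOFF-g8: predicates / discharged hypotheses, not Literature facts).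

* G8.9 dictionary: `norm_le_of_mem_truncIdx`, `mem_truncIdx_of_im_le`, `card_fib_eq_order` (a multiplicity class inside `Γ_N` is full),
  `card_slots_window_eq` (`#slots(t₁,t₂] = N(t₂) − N(t₁)`).
* G8.10 `ordinateBand_of_hsw` (tree fact `zetaZeroCount_hasanalizade_shen_wong` [HSW print fact, locator by referee g6:
  arXiv:2107.06506 p.3], MVT drift `|D(ξ) − D(τ₀)| ≤ 1/(2π·23)` on the window) and row **X-7/HSW** `rh_iff_rhUpTo_and_boundedAwayAt_of_hsw`.
LABEL: K-count RH-FREE over the print fact; the row is CONDITIONAL bookkeeping modulo `MassAwareSampling`.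
HONEST LABEL: «SPLITTING SEARCH over kernel-typed RH-EQUIVALENCES; a splitting A ∧ B ⟹ RH is CONDITIONAL bookkeeping
unless A and B are both proved; nothing here bears on the truth of RH.»
-/

set_option linter.dupNamespace false

noncomputable section

open scoped Classical ComplexConjugate
open Set Filter Topology Complex MeasureTheory

namespace Summit.RiemannHypothesis.RiemannHypothesis.Theorems.Splittings.BombieriTruncMassAware

open Literature.NumberTheory.LFunctions Literature.NumberTheory.LFunctions.Bombieri2000
open Summit.RiemannHypothesis.RiemannHypothesis.Theses.RuelleBand
open Summit.RiemannHypothesis.RiemannHypothesis.Theorems.Splittings.BombieriTruncEigen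
open Summit.RiemannHypothesis.RiemannHypothesis.Theorems.Splittings.BombieriFozNoDep
open Summit.RiemannHypothesis.RiemannHypothesis.Theorems.Splittings.BombieriTruncGram
open Summit.RiemannHypothesis.RiemannHypothesis.Theorems.Splittings.BombieriTruncPairing
open Summit.RiemannHypothesis.RiemannHypothesis.Theorems.Splittings.BombieriTruncScreening
open Summit.RiemannHypothesis.RiemannHypothesis.Theorems.Splittings.BombieriTruncBandGap
open Summit.RiemannHypothesis.RiemannHypothesis.Theorems.Splittings.BombieriTruncMultiplicity
open Summit.RiemannHypothesis.RiemannHypothesis.Theorems.Splittings.BombieriTruncEventualStrip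
open Summit.RiemannHypothesis.RiemannHypothesis.Theorems.Splittings.BombieriTruncExactness
open Summit.RiemannHypothesis.RiemannHypothesis.Theorems.Splittings.BombieriTruncClump
open Summit.RiemannHypothesis.RiemannHypothesis.Theorems.Splittings.BombieriTruncOffLineSparse
open Summit.RiemannHypothesis.RiemannHypothesis.Theorems.Splittings.BombieriTruncSynthesis
open Summit.RiemannHypothesis.RiemannHypothesis.Theorems.Splittings.BombieriTruncSynthesisScreening
open Summit.RiemannHypothesis.RiemannHypothesis.Theorems.Splittings.BombieriTruncSynthesisRows
open Literature.NumberTheory.DiophantineGeometry (RiemannHypothesisUpTo)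

variable {N : ℕ}

/-! ### G8.9 (K-count, dictionary) ordinate-window slot counts of `Γ_N` are `N(t₂) − N(t₁)`

Slots are zeros WITH multiplicity (`ZeroIdx = Σ ρ, Fin m(ρ)`); membership in `Γ_N` depends on the zero only, so a multiplicity class inside `Γ_N` is
full (`card_fib_eq_order`), and the slots with ordinate in `(t₁, t₂]` (`0 < t₁`, `N ≥ t₂ + 2`) are counted by `zetaZeroCount t₂ − zetaZeroCount t₁`. -/

/-- Slots of `Γ_N` satisfy `‖ρ − ½‖ ≤ N`. -/
theorem norm_le_of_mem_truncIdx {N : ℕ} {i : ZeroIdx} (h : i ∈ truncIdx N) : ‖i.val - 1 / 2‖ ≤ N := by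
  rw [truncIdx, Set.Finite.mem_toFinset] at h
  exact h

/-- A slot of height in `[0, t₂]` lies in `Γ_N` once `N ≥ t₂ + 2`. -/
theorem mem_truncIdx_of_im_le {i : ZeroIdx} {t₂ : ℝ} {N : ℕ} (h1 : 0 ≤ i.val.im) (h2 : i.val.im ≤ t₂)
    (hN : t₂ + 2 ≤ (N : ℝ)) : i ∈ truncIdx N := by
  apply mem_truncIdx_of_le
  have hre := i.re_pos_and_lt_one
  have hn1 : ‖i.val‖ ≤ 1 + t₂ := by
    calc ‖i.val‖ ≤ |i.val.re| + |i.val.im| := Complex.norm_le_abs_re_add_abs_im _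
      _ ≤ 1 + t₂ := by
          rw [abs_of_pos hre.1, abs_of_nonneg h1]
          linarith [hre.2]
  have hn2 : ‖(1 / 2 : ℂ)‖ = 1 / 2 := by
    rw [norm_div, norm_one, Complex.norm_two]
  calc ‖i.val - 1 / 2‖ ≤ ‖i.val‖ + ‖(1 / 2 : ℂ)‖ := norm_sub_le _ _
    _ ≤ N := by rw [hn2]; linarith

/-- A multiplicity class inside `Γ_N` is FULL: it has exactly `m(ρ)` slots. -/
theorem card_fib_eq_order (i : truncIdx N) :
    (fib i).card = (riemannZetaZeroOrder (i : ZeroIdx).val).toNat := by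
  apply le_antisymm
  · have h := card_fib_le_order i
    have h0 : 0 ≤ riemannZetaZeroOrder (i : ZeroIdx).val := by
      have := Fin.pos (i : ZeroIdx).2
      change 0 < (riemannZetaZeroOrder (i : ZeroIdx).val).toNat at this
      omega
    have h' : ((fib i).card : ℝ) ≤ ((riemannZetaZeroOrder (i : ZeroIdx).val).toNat : ℝ) := by
      rw [← Int.cast_natCast ((riemannZetaZeroOrder (i : ZeroIdx).val).toNat), Int.toNat_of_nonneg h0]
      exact h
    exact_mod_cast h'
  · have hN := norm_le_of_mem_truncIdx i.2
    let f : Fin (riemannZetaZeroOrder (i : ZeroIdx).val).toNat → truncIdx N :=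
      fun k ↦ ⟨⟨(i : ZeroIdx).1, k⟩, mem_truncIdx_of_le hN⟩
    calc (riemannZetaZeroOrder (i : ZeroIdx).val).toNat
        = (Finset.univ : Finset (Fin (riemannZetaZeroOrder (i : ZeroIdx).val).toNat)).card :=
          (Finset.card_fin _).symm
      _ ≤ (fib i).card :=
          Finset.card_le_card_of_injOn f (fun k _ ↦ by rw [Finset.mem_coe, mem_fib]; rfl)
            (fun k _ l _ hkl ↦ by
              have h' : (⟨(i : ZeroIdx).1, k⟩ : ZeroIdx) = ⟨(i : ZeroIdx).1, l⟩ := congrArg Subtype.val hkl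
              exact eq_of_heq (Sigma.mk.inj_iff.1 h').2)

/-- **Dictionary**: for `0 < t₁ ≤ t₂` and `N ≥ t₂ + 2`, the slots of `Γ_N` with ordinate in `(t₁, t₂]` number `N(t₂) − N(t₁)`
(zeros counted with multiplicity). [new; unconditional] -/
theorem card_slots_window_eq {t₁ t₂ : ℝ} (h0 : 0 < t₁) (h12 : t₁ ≤ t₂) {N : ℕ} (hN : t₂ + 2 ≤ (N : ℝ)) :
    ((((Finset.univ : Finset (truncIdx N)).filter (fun i ↦ t₁ < tau i ∧ tau i ≤ t₂)).card : ℕ) : ℝ) =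
      (zetaZeroCount t₂ : ℝ) - zetaZeroCount t₁ := by
  have hB₁ := zetaZeroBox_finite 0 t₁
  have hB₂ := zetaZeroBox_finite 0 t₂
  have hsub : hB₁.toFinset ⊆ hB₂.toFinset := by
    intro z hz
    rw [Set.Finite.mem_toFinset] at hz ⊢
    obtain ⟨h₁, h₂, h₃, h₄, h₅⟩ := hz
    exact ⟨h₁, h₂, h₃, h₄, h₅.trans h12⟩
  have hcount : ∀ (t : ℝ) (hB : (zetaZeroBox 0 t).Finite),
      ((zetaZeroCount t : ℕ) : ℤ) = ∑ z ∈ hB.toFinset, riemannZetaZeroOrder z := by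
    intro t hB
    unfold zetaZeroCount zetaZeroCountRe
    rw [finsum_mem_eq_finite_toFinset_sum _ hB, Int.toNat_of_nonneg]
    exact Finset.sum_nonneg fun z hz ↦ riemannZetaZeroOrder_nonneg_of_mem_zetaZeroBox (hB.mem_toFinset.1 hz)
  have hWmem : ∀ z : ℂ, z ∈ hB₂.toFinset \ hB₁.toFinset ↔
      riemannZeta z = 0 ∧ 0 ≤ z.re ∧ z.re ≤ 1 ∧ t₁ < z.im ∧ z.im ≤ t₂ := by
    intro z
    rw [Finset.mem_sdiff, Set.Finite.mem_toFinset, Set.Finite.mem_toFinset]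
    show (riemannZeta z = 0 ∧ 0 ≤ z.re ∧ z.re ≤ 1 ∧ 0 < z.im ∧ z.im ≤ t₂) ∧
        ¬ (riemannZeta z = 0 ∧ 0 ≤ z.re ∧ z.re ≤ 1 ∧ 0 < z.im ∧ z.im ≤ t₁) ↔ _
    constructor
    · rintro ⟨⟨h₁, h₂, h₃, h₄, h₅⟩, hn⟩
      refine ⟨h₁, h₂, h₃, ?_, h₅⟩
      by_contra hle
      exact hn ⟨h₁, h₂, h₃, h₄, not_lt.mp hle⟩
    · rintro ⟨h₁, h₂, h₃, h₄, h₅⟩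
      exact ⟨⟨h₁, h₂, h₃, h0.trans h₄, h₅⟩, fun h ↦ absurd h.2.2.2.2 (not_le.mpr h₄)⟩
  -- fiberwise count over the carried zero
  set P : Finset (truncIdx N) :=
    (Finset.univ : Finset (truncIdx N)).filter (fun i ↦ t₁ < tau i ∧ tau i ≤ t₂) with hPdef
  have hH : ∀ i ∈ P, ((i : truncIdx N) : ZeroIdx).val ∈ hB₂.toFinset \ hB₁.toFinset := by
    intro i hi
    rw [hPdef, Finset.mem_filter] at hi
    have hre := ((i : truncIdx N) : ZeroIdx).re_pos_and_lt_one
    exact (hWmem _).2 ⟨(mem_riemannZetaNontrivialZeros_iff_holds.1 ((i : truncIdx N) : ZeroIdx).val_mem).1,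
      hre.1.le, hre.2.le, hi.2.1, hi.2.2⟩
  have hfw := Finset.card_eq_sum_card_fiberwise hH
  -- each fibre is a full multiplicity class
  have hfibre : ∀ z ∈ hB₂.toFinset \ hB₁.toFinset,
      (((P.filter (fun i ↦ ((i : truncIdx N) : ZeroIdx).val = z)).card : ℕ) : ℤ) = riemannZetaZeroOrder z := by
    intro z hz
    obtain ⟨hζ, -, -, h₁, h₂⟩ := (hWmem z).1 hz
    have hntz : z ∈ ZetaZeros.riemannZetaNontrivialZeros :=
      zetaZeroBox_subset_riemannZetaNontrivialZeros 0 t₂ (hB₂.mem_toFinset.1 (Finset.mem_sdiff.1 hz).1)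
    have hz1 : z ≠ 1 := by
      intro h
      rw [h] at h₁
      simp at h₁
      linarith
    have hpos : 0 < riemannZetaZeroOrder z := (riemannZetaZeroOrder_pos_iff hz1).2 hζ
    have hpos' : 0 < (riemannZetaZeroOrder z).toNat := by omega
    let i₀ : ZeroIdx := ⟨⟨z, hntz⟩, ⟨0, hpos'⟩⟩
    have hi₀val : i₀.val = z := rfl
    have hi₀mem : i₀ ∈ truncIdx N :=
      mem_truncIdx_of_im_le (by rw [hi₀val]; linarith) (by rw [hi₀val]; exact h₂) hN
    have hset : P.filter (fun i ↦ ((i : truncIdx N) : ZeroIdx).val = z) = fib ⟨i₀, hi₀mem⟩ := by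
      ext i
      rw [mem_fib, hPdef, Finset.mem_filter, Finset.mem_filter]
      show ((i ∈ Finset.univ ∧ t₁ < tau i ∧ tau i ≤ t₂) ∧ (i : ZeroIdx).val = z) ↔ (i : ZeroIdx).val = i₀.val
      rw [hi₀val]
      constructor
      · exact fun h ↦ h.2
      · intro h
        have ht : tau i = z.im := by unfold tau; rw [h]
        exact ⟨⟨Finset.mem_univ _, by rw [ht]; exact h₁, by rw [ht]; exact h₂⟩, h⟩
    rw [hset, card_fib_eq_order]
    show (((riemannZetaZeroOrder z).toNat : ℕ) : ℤ) = riemannZetaZeroOrder z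
    exact Int.toNat_of_nonneg hpos.le
  -- assemble in ℤ, then cast
  have hZ : ((P.card : ℕ) : ℤ) = (zetaZeroCount t₂ : ℤ) - zetaZeroCount t₁ := by
    rw [hfw, Nat.cast_sum, Finset.sum_congr rfl hfibre, hcount t₂ hB₂, hcount t₁ hB₁, ← Finset.sum_sdiff hsub]
    ring
  have := congrArg (Int.cast : ℤ → ℝ) hZ
  push_cast at this
  exact this

/-! ### G8.10 (K-count, estimate) `OrdinateBand` from the explicit Riemann–von Mangoldt formula (HSW (3.8))

With `N(t) = M(t) ± q(t)` (`M = rvmMain`, `q = hswErr`, tree fact `zetaZeroCount_hasanalizade_shen_wong`), `M' = D = zdens` (tree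
`hasDerivAt_rvmMain`) and the window cap `Λ ≤ τ₀/8π` (density drift `|D(ξ) − D(τ₀)| ≤ 1/(2π·23)` on the window), every interval of length
`≤ 4` holds `D(τ₀)·length ± (2q(τ₀ + τ₀/8π) + 0.03)` slots: `OrdinateBand T₀ δ` as soon as `2q(τ₀(1 + 1/8π)) + 0.03 ≤ δ·D(τ₀)` for `τ₀ > T₀`
— i.e. `δ = 4π·(q/log)(T₀)·(1 + o(1)) → 4π·0.1038 ≈ 1.30`. -/

set_option maxHeartbeats 800000 in
/-- **(K-count) `OrdinateBand T₀ δ` from HSW's explicit `N(T)`**, for every `δ` with `2·q(τ₀ + τ₀/8π) + 3/100 ≤ δ·D(τ₀)` (`τ₀ > T₀ ≥ 3`).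
[new; conditional on the print fact `zetaZeroCount_hasanalizade_shen_wong` only] -/
theorem ordinateBand_of_hsw (h : zetaZeroCount_hasanalizade_shen_wong) {T₀ δ : ℝ} (hT₀ : 3 ≤ T₀)
    (hδ : ∀ τ₀ : ℝ, T₀ < τ₀ → 2 * FordFarZeros.hswErr (τ₀ + τ₀ / (8 * Real.pi)) + 3 / 100 ≤ δ * zdens τ₀) :
    OrdinateBand T₀ δ := by
  intro τ₀ hτ Λ hΛ hΛcap
  refine ⟨⌈τ₀ + Λ + 2⌉₊, fun N hN a b ha hab hb hlen ↦ ?_⟩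
  have hπ := Real.pi_pos
  have hπ3 := Real.pi_gt_three
  have hτ0 : 0 < τ₀ := by linarith
  have h8π : τ₀ / (8 * Real.pi) ≤ τ₀ / 24 :=
    div_le_div_of_nonneg_left hτ0.le (by norm_num) (by linarith)
  have hΛ24 : Λ ≤ τ₀ / 24 := hΛcap.trans h8π
  have he3 : Real.exp 1 < 2.7182818286 := Real.exp_one_lt_d9
  -- the window in absolute heights
  have ht₁pos : 0 < τ₀ + a := by linarith
  have ht₁e : Real.exp 1 ≤ τ₀ + a := by linarith
  have ht₂e : Real.exp 1 ≤ τ₀ + b := by linarith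
  have hNr : (τ₀ + b) + 2 ≤ (N : ℝ) := by
    have : (⌈τ₀ + Λ + 2⌉₊ : ℝ) ≤ N := by exact_mod_cast hN
    linarith [Nat.le_ceil (τ₀ + Λ + 2)]
  -- slot count = N(τ₀+b) − N(τ₀+a)
  have hfilt : (Finset.univ : Finset (truncIdx N)).filter (fun i ↦ a < tau i - τ₀ ∧ tau i - τ₀ ≤ b) =
      (Finset.univ : Finset (truncIdx N)).filter (fun i ↦ τ₀ + a < tau i ∧ tau i ≤ τ₀ + b) := by
    refine Finset.filter_congr fun i _ ↦ ?_
    constructor <;> rintro ⟨h1, h2⟩ <;> constructor <;> linarith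
  have hcnt := card_slots_window_eq ht₁pos (by linarith : τ₀ + a ≤ τ₀ + b) hNr
  rw [← hfilt] at hcnt
  rw [hcnt]
  -- HSW at both ends
  have hlo₁ := (FordFarZeros.hsw_bounds h ht₁e).1
  have hhi₁ := (FordFarZeros.hsw_bounds h ht₁e).2
  have hlo₂ := (FordFarZeros.hsw_bounds h ht₂e).1
  have hhi₂ := (FordFarZeros.hsw_bounds h ht₂e).2
  have hq₁ : FordFarZeros.hswErr (τ₀ + a) ≤ FordFarZeros.hswErr (τ₀ + τ₀ / (8 * Real.pi)) :=
    FordFarZeros.hswErr_mono ht₁e (by linarith)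
  have hq₂ : FordFarZeros.hswErr (τ₀ + b) ≤ FordFarZeros.hswErr (τ₀ + τ₀ / (8 * Real.pi)) :=
    FordFarZeros.hswErr_mono ht₂e (by linarith)
  -- main-term drift by the mean value theorem
  obtain ⟨ξ, hξ, hξeq⟩ := exists_hasDerivAt_eq_slope FordFarZeros.rvmMain
    (fun ξ ↦ 1 / (2 * Real.pi) * Real.log (ξ / (2 * Real.pi))) (by linarith : τ₀ + a < τ₀ + b)
    (FordFarZeros.continuousOn_rvmMain.mono fun x hx ↦ Set.mem_Ioi.2 (ht₁pos.trans_le hx.1))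
    (fun x hx ↦ FordFarZeros.hasDerivAt_rvmMain (ht₁pos.trans hx.1))
  have hξpos : 0 < ξ := ht₁pos.trans hξ.1
  have hξlo : τ₀ - Λ ≤ ξ := by linarith [hξ.1]
  have hξhi : ξ ≤ τ₀ + Λ := by linarith [hξ.2]
  have hMdiff : FordFarZeros.rvmMain (τ₀ + b) - FordFarZeros.rvmMain (τ₀ + a) =
      (b - a) * (1 / (2 * Real.pi) * Real.log (ξ / (2 * Real.pi))) := by
    have hne : (τ₀ + b) - (τ₀ + a) ≠ 0 := by linarith
    have h' := hξeq
    rw [eq_div_iff hne] at h'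
    rw [← h']
    ring
  have hlogdiff : Real.log (ξ / (2 * Real.pi)) - Real.log (τ₀ / (2 * Real.pi)) = Real.log (ξ / τ₀) := by
    rw [Real.log_div hξpos.ne' (by positivity), Real.log_div hτ0.ne' (by positivity),
      Real.log_div hξpos.ne' hτ0.ne']
    ring
  -- |log(ξ/τ₀)| ≤ 1/23
  have hyup : Real.log (ξ / τ₀) ≤ 1 / 24 := by
    refine (Real.log_le_sub_one_of_pos (div_pos hξpos hτ0)).trans ?_
    rw [div_sub_one hτ0.ne', div_le_iff₀ hτ0]
    linarith
  have hylo : -(1 / 23) ≤ Real.log (ξ / τ₀) := by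
    refine le_trans ?_ (Real.one_sub_inv_le_log_of_pos (div_pos hξpos hτ0))
    rw [inv_div, one_sub_div hξpos.ne', le_div_iff₀ hξpos]
    linarith
  have habs : |Real.log (ξ / τ₀)| ≤ 1 / 23 := abs_le.2 ⟨hylo, by linarith⟩
  have h2π : 1 / (2 * Real.pi) ≤ 1 / 6 := one_div_le_one_div_of_le (by norm_num) (by linarith)
  have hdrift : |(b - a) * (1 / (2 * Real.pi) * Real.log (ξ / τ₀))| ≤ 3 / 100 := by
    rw [abs_mul, abs_mul, abs_of_pos (by linarith : 0 < b - a), abs_of_pos (by positivity : 0 < 1 / (2 * Real.pi))]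
    calc (b - a) * (1 / (2 * Real.pi) * |Real.log (ξ / τ₀)|)
        ≤ 4 * (1 / 6 * (1 / 23)) :=
          mul_le_mul hlen (mul_le_mul h2π habs (abs_nonneg _) (by norm_num)) (by positivity) (by norm_num)
      _ ≤ 3 / 100 := by norm_num
  have hd := abs_le.1 hdrift
  have hkey : FordFarZeros.rvmMain (τ₀ + b) - FordFarZeros.rvmMain (τ₀ + a) - zdens τ₀ * (b - a) =
      (b - a) * (1 / (2 * Real.pi) * Real.log (ξ / τ₀)) := by
    rw [hMdiff, ← hlogdiff]
    unfold zdens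
    ring
  have hδτ := hδ τ₀ hτ
  rw [abs_le]
  constructor <;> linarith [hd.1, hd.2, hkey, hlo₁, hhi₁, hlo₂, hhi₂, hq₁, hq₂, hδτ]

/-- Row **X-7♮♮♮ (HSW)**: `MassAwareSampling δ θ ∧ (δ·Φ < 8πθ) ∧ HSW's explicit N(T) ∧ (2q(τ₀(1+1/8π)) + 0.03 ≤ δ·D(τ₀) for τ₀ > T₀) ∧
T₀ ≥ 2π e^{2π}` ⟹ `RH ⟺ RH(T₀) ∧ B′₁([−1,1])` — the ζ-side input is now a PRINT FACT plus explicit arithmetic in `(T₀, δ)`.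
[new; conditional bookkeeping] -/
theorem rh_iff_rhUpTo_and_boundedAwayAt_of_hsw {T₀ δ θ : ℝ} (hθ : 0 < θ) (hS : MassAwareSampling δ θ)
    (hcrit : ∀ κ₀ : ℝ, 0 < κ₀ → κ₀ < 1 / 2 → δ * Phi κ₀ < 8 * Real.pi * θ)
    (hHSW : zetaZeroCount_hasanalizade_shen_wong)
    (hδ : ∀ τ₀ : ℝ, T₀ < τ₀ → 2 * FordFarZeros.hswErr (τ₀ + τ₀ / (8 * Real.pi)) + 3 / 100 ≤ δ * zdens τ₀)
    (hT : 2 * Real.pi * Real.exp (2 * Real.pi) ≤ T₀) :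
    _root_.RiemannHypothesis ↔
      RiemannHypothesisUpTo T₀ ∧ TruncNegEigenvalueBoundedAwayAt (Icc (-1 : ℝ) 1) 1 :=
  rh_iff_rhUpTo_and_boundedAwayAt_of_ordinateBand hθ hS hcrit
    (ordinateBand_of_hsw hHSW (le_trans (by
      have := Real.pi_gt_three
      have h1 : (1 : ℝ) ≤ Real.exp (2 * Real.pi) := Real.one_le_exp (by positivity)
      nlinarith) hT) hδ) hT

end Summit.RiemannHypothesis.RiemannHypothesis.Theorems.Splittings.BombieriTruncMassAware
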